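import Literature.Barriers.CriticalPhenomena.PlaquetteWalkYBCurveIdentity
import HarnessLib

/-!
# Barrier catalogue (SAWScalingLimit): the Yang–Baxter curve identity at FOUR of the sixteen spins —
complex conjugation (`σ ↦ −σ`) and phase reversal (`σ ↦ σ + 2`)

Companion of `PlaquetteWalkYBCurveIdentity` (the exact vertex identity on the whole complexified
Yang–Baxter curve at `t = e^{−5iπ/16}`). The vertex functional is a polynomial with integer structure in
the five weights, the phase `t^{±1}` and the coefficients, so complex conjugation maps solutions to
solutions (`conj_vertexFunctional`): `(W, t, c) ↦ (W̄, t̄, c̄)`. Since the curve is defined over `ℚ`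
(`conj_ybCurve : conj (ybCurve ε t r) = ybCurve ε̄ t̄ r̄` componentwise), the identity at
`t = e^{−5iπ/16}` (`PlaquetteWalkYBCurveIdentity_holds`) gives the identity at the conjugate sixteenth
root `t̄ = e^{+5iπ/16}` — the second of the sixteen spins `t¹⁶ = −1` allowed by
`PlaquetteWalkSpinRigidity` (`σ = −5/8 ≡ 27/8`): `vertexFunctional_ybCurve_conj_eq_zero`, named
`PlaquetteWalkYBCurveIdentityConj_holds`. A second symmetry, the PHASE REVERSAL `t ↦ −t`
(`σ ↦ σ + 2`): the number of quarter turns of a walk has the parity of «the end mid-edges have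
different orientations» (`neg_one_zpow_quarterTurnsL_walk`), so `Φ(W, −t, c) = ±Φ(W, t, (c_E, −c_N,
c_W, −c_S))` (`vertexFunctional_neg`), while the curve is invariant under `(t, r) ↦ (−t, −r)`
(`ybCurve_neg`); hence the identity at `−t₀` and `−t̄₀` too — four of the sixteen spins
(`PlaquetteWalkYBCurveIdentityFourSpins_holds`). The remaining twelve roots are NOT treated here
(the venture lane «pcv-sawmu» records float evidence that all sixteen carry the identity:
conjecture C-B4; `t ↦ e^{iπ/4} t` is not a symmetry of the slot functional).

Sources: the printed `σ = ℓ/8` families [cite: Glazman2015WeightedSAW, Lemma 3.1 (ECP 20 (2015) no. 86, pp. 5–6)];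
the relation shape [cite: GlazmanManolescu2019, Lemma 2.1].

Status in print (venture lane «pcv-sawmu», label cell of record lit-2 g16, 2026-08-23: CONSOLIDATION of
symmetries; off the unit circle the status is that of `PlaquetteWalkYBCurveIdentity`): for every odd `ℓ`
the rhombus relation (3.2) with coefficients `(1, e^{iθ}, −1, −e^{iθ})` has unique weights
[cite: Glazman2015WeightedSAW, Lemma 3.1 (ECP 20 (2015) no. 86 pp. 5–6; proof p. 7 via the local system (3.11)–(3.14) and its complex conjugate; Remark 4.2 p. 8; Appendix Prop. 5.1 p. 11)];
the conjugate-spin and phase-reversed identities proved here are the images of the curve identity at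
`t₀` under `t ↦ t̄` and `t ↦ −t`, the latter acting on the weights by `(u₁, u₂) ↦ (−u₁, −u₂)` as in
(3.3)–(3.7) at `θ = π/2` (here: `ybCurve ε (−t) (−r) = ybCurve ε t r` together with `r ↦ −r`).

Written for the venture lane «pcv-sawmu» (Tier B; b-engine-1 gen 10).
-/

noncomputable section

namespace Literature.Barriers.CriticalPhenomena.PlaquetteWalk

open Literature.Probability.RandomPlanarGeometry.SAW.YangBaxter Real Complex

/-- Componentwise complex conjugate of a weight system. [cite: GlazmanManolescu2019, §1, eq. (1)] -/
def CWeights.conj (W : CWeights) : CWeights :=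
  ⟨starRingEnd ℂ W.u₁, starRingEnd ℂ W.u₂, starRingEnd ℂ W.v, starRingEnd ℂ W.w₁, starRingEnd ℂ W.w₂⟩

/-- Conjugation of the plaquette weight of a mid-edge list. [folklore] -/
private theorem conj_weightL (W : CWeights) (l : List MidEdge) :
    starRingEnd ℂ (weightL W l) = weightL W.conj l := by
  simp only [weightL, CWeights.mono, CWeights.conj, map_mul, map_pow]

/-- Conjugation of the free-weight observable: `conj F_{W,t}(z) = F_{W̄,t̄}(z)`.
[cite: GlazmanManolescu2019, §2.1, eq. (6) (arXiv v3 p. 6)] -/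
theorem conj_gmObservable (W : CWeights) (t : ℂ) (Dl : List Face) (a z : MidEdge) :
    starRingEnd ℂ (gmObservable W t Dl a z) = gmObservable W.conj (starRingEnd ℂ t) Dl a z := by
  unfold gmObservable
  rw [map_sum]
  refine Finset.sum_congr rfl fun γ _ => ?_
  rw [map_mul, conj_weightL, map_zpow₀]

/-- **Conjugation symmetry of the vertex functional**: `conj Φ(W, t, c) = Φ(W̄, t̄, c̄)`.
[cite: DuminilCopinSmirnov2012, Lemma 1 (shape of the relation)] -/
theorem conj_vertexFunctional (W : CWeights) (t : ℂ) (c : Fin 4 → ℂ) (Dl : List Face) (a : MidEdge)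
    (f₀ : Face) :
    starRingEnd ℂ (vertexFunctional W t c Dl a f₀) =
      vertexFunctional W.conj (starRingEnd ℂ t) (fun i => starRingEnd ℂ (c i)) Dl a f₀ := by
  unfold vertexFunctional
  rw [map_sum]
  refine Finset.sum_congr rfl fun s _ => ?_
  rw [map_mul, conj_gmObservable]

/-- The curve's straight weight is defined over `ℚ`: conjugation acts on the parameters. [folklore] -/
private theorem conj_ybV (ε t r : ℂ) :
    starRingEnd ℂ (ybV ε t r) = ybV (starRingEnd ℂ ε) (starRingEnd ℂ t) (starRingEnd ℂ r) := by
  simp only [ybV, map_div₀, map_neg, map_mul, map_sub, map_add, map_pow, map_one]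

/-- Same for the corner weight. [folklore] -/
private theorem conj_ybU1 (ε t r : ℂ) :
    starRingEnd ℂ (ybU1 ε t r) = ybU1 (starRingEnd ℂ ε) (starRingEnd ℂ t) (starRingEnd ℂ r) := by
  simp only [ybU1, map_div₀, map_mul, map_sub, map_add, map_pow, map_one, conj_ybV]

/-- Same for the co-corner weight. [folklore] -/
private theorem conj_ybU2 (ε t r : ℂ) :
    starRingEnd ℂ (ybU2 ε t r) = ybU2 (starRingEnd ℂ ε) (starRingEnd ℂ t) (starRingEnd ℂ r) := by
  simp only [ybU2, map_div₀, map_neg, map_mul, map_sub, map_add, map_pow, map_one, conj_ybV, conj_ybU1]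

/-- Same for the two-corner weight. [folklore] -/
private theorem conj_ybW1 (ε t r : ℂ) :
    starRingEnd ℂ (ybW1 ε t r) = ybW1 (starRingEnd ℂ ε) (starRingEnd ℂ t) (starRingEnd ℂ r) := by
  simp only [ybW1, map_div₀, map_neg, map_mul, map_sub, map_pow, conj_ybV, conj_ybU1]

/-- Same for the two-co-corner weight. [folklore] -/
private theorem conj_ybW2 (ε t r : ℂ) :
    starRingEnd ℂ (ybW2 ε t r) = ybW2 (starRingEnd ℂ ε) (starRingEnd ℂ t) (starRingEnd ℂ r) := by
  simp only [ybW2, map_div₀, map_neg, map_mul, map_sub, map_pow, conj_ybV, conj_ybU2]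

/-- **The Yang–Baxter curve is defined over `ℚ`**: `conj (ybCurve ε t r) = ybCurve ε̄ t̄ r̄`.
[cite: Glazman2015WeightedSAW, Lemma 3.1 (the closed-form weights, rational in the parameters)] -/
theorem conj_ybCurve (ε t r : ℂ) :
    (ybCurve ε t r).conj = ybCurve (starRingEnd ℂ ε) (starRingEnd ℂ t) (starRingEnd ℂ r) := by
  simp only [ybCurve, CWeights.conj, conj_ybV, conj_ybU1, conj_ybU2, conj_ybW1, conj_ybW2]

/-- The conjugate phase `t̄ = e^{+5iπ/16}` (`σ = −5/8`). [cite: Glazman2015WeightedSAW, Lemma 3.1 (σ = ℓ/8)] -/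
def tMinusFiveEighths : ℂ := starRingEnd ℂ tFiveEighths

/-- `t̄¹⁶ = −1`: the conjugate phase is again an admissible spin. [cite: Glazman2015WeightedSAW, Lemma 3.1 (σ = ℓ/8)] -/
theorem tMinusFiveEighths_pow_sixteen : tMinusFiveEighths ^ 16 = -1 := by
  rw [tMinusFiveEighths, ← map_pow, tFiveEighths_pow_sixteen, map_neg, map_one]

/-- Conjugation of the odd coefficient vector. [cite: GlazmanManolescu2019, Lemma 2.1, eq. (7)] -/
private theorem conj_oddCoeff (r : ℂ) :
    (fun i => starRingEnd ℂ (oddCoeff r i)) = oddCoeff (starRingEnd ℂ r) := by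
  funext i
  fin_cases i <;> simp [oddCoeff]

/-- **The curve identity at the conjugate spin** `t̄ = e^{+5iπ/16}`: for every `r ∈ ℂ` with `r ≠ 0`
and `t̄⁶(1 + r⁴) ≠ (1 + t̄¹²) r²`, the weights `ybCurve (−1) t̄ r` satisfy
`F(z_E) + rF(z_N) − F(z_W) − rF(z_S) = 0` at every face of every finite face list for every outer
root — by conjugating `vertexFunctional_ybCurve_eq_zero` at `r̄`.
[cite: Glazman2015WeightedSAW, Lemma 3.1 (the σ = ℓ/8 families)] -/
theorem vertexFunctional_ybCurve_conj_eq_zero {r : ℂ} (hr : r ≠ 0)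
    (hD : tMinusFiveEighths ^ 6 * (1 + r ^ 4) - (1 + tMinusFiveEighths ^ 12) * r ^ 2 ≠ 0)
    (Dl : List Face) (a : MidEdge) (hO : OuterRoot (dom Dl) a) (f₀ : Face) (hf : f₀ ∈ Dl) :
    vertexFunctional (ybCurve (-1) tMinusFiveEighths r) tMinusFiveEighths (oddCoeff r) Dl a f₀ = 0 := by
  -- the conjugate point `r̄` is a good point of the curve at `t₀`
  have hr' : starRingEnd ℂ r ≠ 0 := by
    intro h; exact hr (by simpa using congrArg (starRingEnd ℂ) h)
  have hD' : tFiveEighths ^ 6 * (1 + starRingEnd ℂ r ^ 4) -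
      (1 + tFiveEighths ^ 12) * starRingEnd ℂ r ^ 2 ≠ 0 := by
    intro h
    apply hD
    have h2 := congrArg (starRingEnd ℂ) h
    simp only [map_sub, map_mul, map_add, map_pow, map_one, Complex.conj_conj, map_zero] at h2
    rw [tMinusFiveEighths]
    exact h2
  have key := congrArg (starRingEnd ℂ)
    (vertexFunctional_ybCurve_eq_zero hr' hD' Dl a hO f₀ hf)
  rw [map_zero, conj_vertexFunctional, conj_ybCurve, conj_oddCoeff] at key
  simpa [tMinusFiveEighths] using key

/-- **Named statement `PlaquetteWalkYBCurveIdentityConj`**: the curve identity at the conjugate spin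
`σ = −5/8` (`t = e^{+5iπ/16}`): every good point `ybCurve (−1) t r` carries the exact vertex identity
with coefficients `(1, r, −1, −r)` on every finite face list for every outer root.
[cite: Glazman2015WeightedSAW, Lemma 3.1 (the σ = ℓ/8 families)] -/
def _root_.Literature.Barriers.CriticalPhenomena.PlaquetteWalkYBCurveIdentityConj : Prop :=
  ∀ r : ℂ, r ≠ 0 → tMinusFiveEighths ^ 6 * (1 + r ^ 4) - (1 + tMinusFiveEighths ^ 12) * r ^ 2 ≠ 0 →
    ∀ (Dl : List Face) (a : MidEdge) (f₀ : Face), f₀ ∈ Dl → OuterRoot (dom Dl) a →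
      vertexFunctional (ybCurve (-1) tMinusFiveEighths r) tMinusFiveEighths (oddCoeff r) Dl a f₀ = 0

/-- **`PlaquetteWalkYBCurveIdentityConj` holds.** [cite: Glazman2015WeightedSAW, Lemma 3.1 (the σ = ℓ/8 families)] -/
theorem _root_.Literature.Barriers.CriticalPhenomena.PlaquetteWalkYBCurveIdentityConj_holds :
    PlaquetteWalkYBCurveIdentityConj :=
  fun _ hr hD Dl a f₀ hf hO => vertexFunctional_ybCurve_conj_eq_zero hr hD Dl a hO f₀ hf

/-! ### The phase reversal `t ↦ −t` (`σ ↦ σ + 2`): two more spins, `±t₀` and `±t̄₀` -/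

/-- Orientation sign of a mid-edge: `+1` for a vertical mid-edge (sides `W`, `E`), `−1` for a
horizontal one (sides `S`, `N`). [cite: GlazmanManolescu2019, §1, Fig. 4] -/
def orientSign : MidEdge → ℂ
  | .vert _ _ => 1
  | .slant _ _ => -1

/-- `orientSign m ^ 2 = 1`. [folklore] -/
private theorem orientSign_mul_self (m : MidEdge) : orientSign m * orientSign m = 1 := by
  cases m <;> simp [orientSign]

/-- **Turn parity of one arc**: an arc drawn in a face turns by an odd number of quarter turns iff
it joins a vertical and a horizontal side: `(−1)^{q(p)} = σ(p.1) σ(p.2)`. [folklore] -/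
private theorem neg_one_zpow_qTurnOf {p : MidEdge × MidEdge} {f : Face} (h : arcFace p = some f) :
    (-1 : ℂ) ^ qTurnOf p = orientSign p.1 * orientSign p.2 := by
  obtain ⟨m, m'⟩ := p
  have h' : MidEdge.commonFace m m' = some f := h
  obtain ⟨-, ⟨s, hs⟩, ⟨u, hu⟩⟩ := (MidEdge.commonFace_eq_some_iff m m' f).1 h'
  subst hs; subst hu
  simp only [qTurnOf, h, Face.sideOf_side]
  cases s <;> cases u <;> simp [qTurn, Face.side, orientSign, zpow_ofNat, zpow_neg]

/-- **Turn parity of a mid-edge list all of whose arcs are drawn in faces**: the total number of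
quarter turns has the parity of «first and last mid-edge have different orientations»:
`(−1)^{q(l)} = σ(first) σ(last)`. [folklore] -/
private theorem neg_one_zpow_quarterTurnsL : ∀ (l : List MidEdge) (x : MidEdge),
    (∀ p ∈ arcsOf (x :: l), ∃ f : Face, arcFace p = some f) →
      (-1 : ℂ) ^ quarterTurnsL (x :: l) = orientSign x * orientSign ((x :: l).getLast (by simp)) := by
  intro l
  induction l with
  | nil =>
    intro x _
    simp [quarterTurnsL, orientSign_mul_self]
  | cons y l ih =>
    intro x harc
    have hxy : ∃ f : Face, arcFace (x, y) = some f := harc (x, y) (by simp)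
    obtain ⟨f, hf⟩ := hxy
    have hrest : ∀ p ∈ arcsOf (y :: l), ∃ f : Face, arcFace p = some f :=
      fun p hp => harc p (by simp [hp])
    have hq : quarterTurnsL (x :: y :: l) = qTurnOf (x, y) + quarterTurnsL (y :: l) := by
      simp [quarterTurnsL]
    rw [hq, zpow_add₀ (by norm_num : (-1 : ℂ) ≠ 0), neg_one_zpow_qTurnOf hf, ih y hrest,
      List.getLast_cons_cons]
    calc orientSign x * orientSign y * (orientSign y * orientSign ((y :: l).getLast (by simp)))
        = orientSign x * (orientSign y * orientSign y) * orientSign ((y :: l).getLast (by simp)) := by ring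
      _ = orientSign x * orientSign ((y :: l).getLast (by simp)) := by rw [orientSign_mul_self, mul_one]

/-- **Turn parity of a Yang–Baxter walk**: `(−1)^{q(γ)} = σ(a) σ(z)`.
[cite: GlazmanManolescu2019, §2.1 (the winding of a walk from a to z)] -/
theorem neg_one_zpow_quarterTurnsL_walk {D : Set Face} {a z : MidEdge} (γ : YBWalk D a z) :
    (-1 : ℂ) ^ quarterTurnsL γ.mids = orientSign a * orientSign z := by
  have hne : γ.mids ≠ [] := by
    intro h; have := γ.head_eq; rw [h] at this; simp at this
  obtain ⟨x, l, hxl⟩ : ∃ x l, γ.mids = x :: l := by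
    cases h : γ.mids with
    | nil => exact absurd h hne
    | cons x l => exact ⟨x, l, rfl⟩
  have hx : x = a := by
    have := γ.head_eq; rw [hxl] at this; simpa using this
  have hz : (x :: l).getLast (by simp) = z := by
    have := γ.getLast_eq
    rw [hxl, List.getLast?_eq_some_getLast (by simp)] at this
    exact Option.some_injective _ this
  have harc : ∀ p ∈ arcsOf (x :: l), ∃ f : Face, arcFace p = some f := fun p hp => by
    obtain ⟨f, -, hf⟩ := γ.arc_mem p (by rw [hxl]; exact hp)
    exact ⟨f, hf⟩
  subst hx
  rw [hxl, neg_one_zpow_quarterTurnsL l _ harc, hz]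

/-- **Phase reversal of the observable**: `F_{W,−t}(z) = σ(a)σ(z) F_{W,t}(z)`.
[cite: GlazmanManolescu2019, §2.1, eq. (6) (arXiv v3 p. 6)] -/
theorem gmObservable_neg (W : CWeights) (t : ℂ) (Dl : List Face) (a z : MidEdge) :
    gmObservable W (-t) Dl a z = orientSign a * orientSign z * gmObservable W t Dl a z := by
  unfold gmObservable
  rw [Finset.mul_sum]
  refine Finset.sum_congr rfl fun γ _ => ?_
  rw [show (-t) = (-1) * t by ring, mul_zpow, neg_one_zpow_quarterTurnsL_walk γ]
  ring

/-- The phase-reversed coefficient vector `(c_E, −c_N, c_W, −c_S)`. [cite: DuminilCopinSmirnov2012, Lemma 1 (shape of the relation)] -/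
def negCoeff (c : Fin 4 → ℂ) : Fin 4 → ℂ := ![c 0, -c 1, c 2, -c 3]

/-- **Phase reversal of the vertex functional**: `Φ(W, −t, c) = σ(a) Φ(W, t, negCoeff c)` — the
slots `E, W` are vertical, `N, S` horizontal. [cite: DuminilCopinSmirnov2012, Lemma 1 (shape of the relation)] -/
theorem vertexFunctional_neg (W : CWeights) (t : ℂ) (c : Fin 4 → ℂ) (Dl : List Face) (a : MidEdge)
    (f₀ : Face) :
    vertexFunctional W (-t) c Dl a f₀ = orientSign a * vertexFunctional W t (negCoeff c) Dl a f₀ := by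
  unfold vertexFunctional
  simp only [Fin.sum_univ_four, gmObservable_neg]
  have e0 : slotSide f₀ 0 = f₀.side .E := rfl
  have e1 : slotSide f₀ 1 = f₀.side .N := rfl
  have e2 : slotSide f₀ 2 = f₀.side .W := rfl
  have e3 : slotSide f₀ 3 = f₀.side .S := rfl
  have c0 : negCoeff c 0 = c 0 := rfl
  have c1 : negCoeff c 1 = -c 1 := rfl
  have c2 : negCoeff c 2 = c 2 := rfl
  have c3 : negCoeff c 3 = -c 3 := rfl
  rw [e0, e1, e2, e3, c0, c1, c2, c3]
  simp only [Face.side, orientSign]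
  ring

/-- The curve is invariant under `(t, r) ↦ (−t, −r)`: straight weight. [folklore] -/
private theorem ybV_neg (ε t r : ℂ) : ybV ε (-t) (-r) = ybV ε t r := by
  unfold ybV; ring

/-- Same, corner weight. [folklore] -/
private theorem ybU1_neg (ε t r : ℂ) : ybU1 ε (-t) (-r) = ybU1 ε t r := by
  unfold ybU1
  rw [ybV_neg]
  calc -t * (1 + ε * ybV ε t r) * ((-r) ^ 2 - (-t) ^ 2) / (ε * -r * ((-t) ^ 4 - 1))
      = (-(t * (1 + ε * ybV ε t r) * (r ^ 2 - t ^ 2))) / (-(ε * r * (t ^ 4 - 1))) := by ring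
    _ = t * (1 + ε * ybV ε t r) * (r ^ 2 - t ^ 2) / (ε * r * (t ^ 4 - 1)) := neg_div_neg_eq _ _

/-- Same, co-corner weight. [folklore] -/
private theorem ybU2_neg (ε t r : ℂ) : ybU2 ε (-t) (-r) = ybU2 ε t r := by
  unfold ybU2; rw [ybV_neg, ybU1_neg]; ring

/-- Same, two-corner weight. [folklore] -/
private theorem ybW1_neg (ε t r : ℂ) : ybW1 ε (-t) (-r) = ybW1 ε t r := by
  unfold ybW1; rw [ybV_neg, ybU1_neg]; ring

/-- Same, two-co-corner weight. [folklore] -/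
private theorem ybW2_neg (ε t r : ℂ) : ybW2 ε (-t) (-r) = ybW2 ε t r := by
  unfold ybW2
  rw [ybV_neg, ybU2_neg]
  calc (-ε * ybV ε t r * (-t) ^ 5 - ybU2 ε t r * -r) / -t
      = (-(-ε * ybV ε t r * t ^ 5 - ybU2 ε t r * r)) / (-t) := by ring
    _ = (-ε * ybV ε t r * t ^ 5 - ybU2 ε t r * r) / t := neg_div_neg_eq _ _

/-- **The Yang–Baxter curve is invariant under `(t, r) ↦ (−t, −r)`.**
[cite: Glazman2015WeightedSAW, Lemma 3.1 (the closed-form weights)] -/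
theorem ybCurve_neg (ε t r : ℂ) : ybCurve ε (-t) (-r) = ybCurve ε t r := by
  simp only [ybCurve, ybV_neg, ybU1_neg, ybU2_neg, ybW1_neg, ybW2_neg]

/-- `negCoeff (oddCoeff r) = oddCoeff (−r)`. [cite: GlazmanManolescu2019, Lemma 2.1, eq. (7)] -/
private theorem negCoeff_oddCoeff (r : ℂ) : negCoeff (oddCoeff r) = oddCoeff (-r) := by
  funext i
  fin_cases i <;> simp [negCoeff, oddCoeff]

/-- **The curve identity at the phase-reversed spin `−t`**, from the identity at `t`, for any `t`
with the curve identity for all good `r` (applied below to `t₀` and `t̄₀`).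
[cite: Glazman2015WeightedSAW, Lemma 3.1 (the σ = ℓ/8 families)] -/
private theorem curveIdentity_neg {t : ℂ}
    (H : ∀ r : ℂ, r ≠ 0 → t ^ 6 * (1 + r ^ 4) - (1 + t ^ 12) * r ^ 2 ≠ 0 →
      ∀ (Dl : List Face) (a : MidEdge) (f₀ : Face), f₀ ∈ Dl → OuterRoot (dom Dl) a →
        vertexFunctional (ybCurve (-1) t r) t (oddCoeff r) Dl a f₀ = 0)
    {r : ℂ} (hr : r ≠ 0) (hD : (-t) ^ 6 * (1 + r ^ 4) - (1 + (-t) ^ 12) * r ^ 2 ≠ 0)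
    (Dl : List Face) (a : MidEdge) (hO : OuterRoot (dom Dl) a) (f₀ : Face) (hf : f₀ ∈ Dl) :
    vertexFunctional (ybCurve (-1) (-t) r) (-t) (oddCoeff r) Dl a f₀ = 0 := by
  have hr' : -r ≠ 0 := neg_ne_zero.2 hr
  have hD' : t ^ 6 * (1 + (-r) ^ 4) - (1 + t ^ 12) * (-r) ^ 2 ≠ 0 := by
    intro h; apply hD; linear_combination h
  rw [vertexFunctional_neg, negCoeff_oddCoeff, show ybCurve (-1) (-t) r = ybCurve (-1) t (-r) by
    rw [← ybCurve_neg (-1) (-t) r, neg_neg], H (-r) hr' hD' Dl a f₀ hf hO, mul_zero]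

/-- **The curve identity at `−t₀ = −e^{−5iπ/16}`** (`σ = 5/8 + 2`).
[cite: Glazman2015WeightedSAW, Lemma 3.1 (the σ = ℓ/8 families)] -/
theorem vertexFunctional_ybCurve_negT_eq_zero {r : ℂ} (hr : r ≠ 0)
    (hD : (-tFiveEighths) ^ 6 * (1 + r ^ 4) - (1 + (-tFiveEighths) ^ 12) * r ^ 2 ≠ 0)
    (Dl : List Face) (a : MidEdge) (hO : OuterRoot (dom Dl) a) (f₀ : Face) (hf : f₀ ∈ Dl) :
    vertexFunctional (ybCurve (-1) (-tFiveEighths) r) (-tFiveEighths) (oddCoeff r) Dl a f₀ = 0 :=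
  curveIdentity_neg (fun _ hr hD Dl a f₀ hf hO => vertexFunctional_ybCurve_eq_zero hr hD Dl a hO f₀ hf)
    hr hD Dl a hO f₀ hf

/-- **The curve identity at `−t̄₀ = −e^{+5iπ/16}`** (`σ = −5/8 + 2`).
[cite: Glazman2015WeightedSAW, Lemma 3.1 (the σ = ℓ/8 families)] -/
theorem vertexFunctional_ybCurve_negConjT_eq_zero {r : ℂ} (hr : r ≠ 0)
    (hD : (-tMinusFiveEighths) ^ 6 * (1 + r ^ 4) - (1 + (-tMinusFiveEighths) ^ 12) * r ^ 2 ≠ 0)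
    (Dl : List Face) (a : MidEdge) (hO : OuterRoot (dom Dl) a) (f₀ : Face) (hf : f₀ ∈ Dl) :
    vertexFunctional (ybCurve (-1) (-tMinusFiveEighths) r) (-tMinusFiveEighths) (oddCoeff r) Dl a f₀ = 0 :=
  curveIdentity_neg (fun _ hr hD Dl a f₀ hf hO => vertexFunctional_ybCurve_conj_eq_zero hr hD Dl a hO f₀ hf)
    hr hD Dl a hO f₀ hf

/-- **Named statement `PlaquetteWalkYBCurveIdentityFourSpins`**: the curve identity holds at the
four spins `t ∈ {e^{−5iπ/16}, e^{+5iπ/16}, −e^{−5iπ/16}, −e^{+5iπ/16}}` (`σ ≡ ±5/8, ±5/8 + 2 (mod 4)`)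
of the sixteen admissible ones: every good point `ybCurve (−1) t r` carries
`F(z_E) + rF(z_N) − F(z_W) − rF(z_S) = 0` on every finite face list for every outer root.
[cite: Glazman2015WeightedSAW, Lemma 3.1 (the σ = ℓ/8 families)] -/
def _root_.Literature.Barriers.CriticalPhenomena.PlaquetteWalkYBCurveIdentityFourSpins : Prop :=
  ∀ t ∈ ({tFiveEighths, tMinusFiveEighths, -tFiveEighths, -tMinusFiveEighths} : Set ℂ),
    ∀ r : ℂ, r ≠ 0 → t ^ 6 * (1 + r ^ 4) - (1 + t ^ 12) * r ^ 2 ≠ 0 →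
      ∀ (Dl : List Face) (a : MidEdge) (f₀ : Face), f₀ ∈ Dl → OuterRoot (dom Dl) a →
        vertexFunctional (ybCurve (-1) t r) t (oddCoeff r) Dl a f₀ = 0

/-- **`PlaquetteWalkYBCurveIdentityFourSpins` holds.** [cite: Glazman2015WeightedSAW, Lemma 3.1 (the σ = ℓ/8 families)] -/
theorem _root_.Literature.Barriers.CriticalPhenomena.PlaquetteWalkYBCurveIdentityFourSpins_holds :
    PlaquetteWalkYBCurveIdentityFourSpins := by
  intro t ht r hr hD Dl a f₀ hf hO
  simp only [Set.mem_insert_iff, Set.mem_singleton_iff] at ht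
  rcases ht with rfl | rfl | rfl | rfl
  · exact vertexFunctional_ybCurve_eq_zero hr hD Dl a hO f₀ hf
  · exact vertexFunctional_ybCurve_conj_eq_zero hr hD Dl a hO f₀ hf
  · exact vertexFunctional_ybCurve_negT_eq_zero hr hD Dl a hO f₀ hf
  · exact vertexFunctional_ybCurve_negConjT_eq_zero hr hD Dl a hO f₀ hf

end Literature.Barriers.CriticalPhenomena.PlaquetteWalk
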